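import Literature.NumberTheory.GaloisCohomology.CyclicClassLocalArtinSymbolSideConditions
import Literature.NumberTheory.GaloisCohomology.KummerClassLocalPower
import Literature.NumberTheory.GaloisRepresentations.LocalUnitGroupFiniteIndexOpen
import Literature.NumberTheory.GaloisRepresentations.HeckeCharacterWeakApproximation
import HarnessLib

/-!
# The local invariant of a global cyclic class is the local Artin symbol, II: every place, every `b`
# (Serre, *Corps locaux* XIV §1 Prop. 3: `(χ, b)_v = χ(s_b)`)

Let `K` be a number field, `n ≥ 1`, `ψ : Γ_K ↠ ℤ/n` a cyclic character cutting out the finite abelian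
`L ⊆ K̄` (`ker ψ = Gal(K̄/L)`), `b ∈ Kˣ`, `v` a finite place, `inv_v = localInvariantMap K n v` THE invariant
map of `K_v`, `Art_v = canonicalArtin K_v` THE local Artin map (Deligne's normalisation).

**Theorem** (`localInvariantMap_localization_cupProduct_δ₀_eq_neg_apply`).  For EVERY finite place `v`,
EVERY `b ∈ Kˣ` and every `w ∈ W_{K_v}` with `Art_v w = b`,

  `inv_v (loc_v (κₙ(b) ∪ ψ)) = -ψ(res_v w)`

— Serre's `(χ, b)_v = χ(s_b)` (*Corps locaux* XIV §1 Prop. 3, `s_b = (b, */K_v)` the reciprocity map) for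
the characters `χ = ψ ∘ res_v` that are restrictions of global cyclic characters; equivalently
`inv_v (loc_v (κₙ(b) ∪ ψ))` is `ψ̄(ψ_{L|K}⟨b⟩_v)` for the local Artin symbol of the idèle `⟨b⟩_v`
(`artinIdeleMap_localUnits_canonicalArtin_eq_inv`).  The prequel
(`CyclicClassLocalArtinSymbolSideConditions.lean`, Tate's device) proves it for `b` positive at the real
places with `loc_{v'}(κₙ(b) ∪ ψ) = 0` at the ramified `v' ≠ v`.  Here the side conditions are removed:

* both sides are additive in `b` (`baseUnitsInvariant_mul`; `ψ̄ ∘ ψ_{L|K} ∘ ⟨·⟩_v` is a homomorphism);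
* both vanish on `U = N_{K_vL/K_v}((K_vL)ˣ) ∩ (K_vˣ)ⁿ`: the Artin side on local norms
  (`artinIdeleMap_localUnits_eq_one_iff_mem_range_norm`), the invariant side on local `n`-th powers
  (`localization_cupProduct_δ₀_eq_zero_of_eq_pow`); `U` is OPEN in `K_vˣ` (finite-index subgroups and
  `n`-th powers are open, `LocalUnitGroupFiniteIndexOpen`);
* by weak approximation (`denseRange_algebraMap_pi_prod`, at `{v} ∪ S₀` and the real places, `S₀` a norm
  modulus of `L/K` off which `ψ` is unramified) every `b` is `b₁ · u` with `u ∈ U` at `v` and `b₁ ∈ Kˣ` an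
  `n`-th power at the places of `S₀ ∖ {v}` and positive at the real places — to which the prequel applies.

Proof file: theorems only (no definition, no named fact, no instance; D-0026).  HONEST FRAMING: textbook
class field theory; proves no case of Poitou–Tate duality `Ker γ¹ ⊆ Im β¹` and no case of BSD — it is the
ramified local value identity on which the `μₙ` / `ℤ/n` cases of Milne *ADT* I Thm. 4.10(b) for THE
invariant maps rest (cell bsd-schneider-ideate, crux `AnticycControlAdditiveK`, FINDING door-c6 g5 §6 (C)).

## References

* J.-P. Serre, *Corps locaux* / *Local Fields* (1979), XIV §1 Prop. 3. [SerreLocalFields1979]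
* J. Tate, *Global class field theory*, Ch. VII of Cassels–Fröhlich (1967), §10, §11. [CasselsFrohlichANT1967]
* J. Neukirch, *Algebraic Number Theory* (1999), II (5.7), VI (5.6)–(5.8). [NeukirchANT1999]

## Tree search

`lean search 'localInvariantMap_localization_cupProduct_δ₀|invLevel_cupProduct'`: only the unramified
evaluations.  Inputs: the prequel, `KummerClassLocalPower.localization_cupProduct_δ₀_eq_zero_of_eq_pow`,
`ArtinMapLocalNormKernel` (`index_range_norm_ne_zero`, `artinIdeleMap_localUnits_eq_one_iff_mem_range_norm`),
`LocalUnitGroupFiniteIndexOpen`, `HeckeCharacterWeakApproximation.denseRange_algebraMap_pi_prod`, Mathlib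
`Units.isEmbedding_val₀`, `DenseRange.exists_mem_open`.
-/

noncomputable section

open CategoryTheory Function NumberField IsDedekindDomain Field ValuativeRel
open scoped NumberField

namespace Literature.NumberTheory.GaloisCohomology

open _root_.ContinuousCohomology
open Literature.NumberTheory.GaloisRepresentations
open Literature.NumberTheory.GaloisRepresentations.DiscreteGaloisModule
open Literature.NumberTheory.GaloisRepresentations.LocalWeilDatum
open Literature.NumberTheory.GaloisRepresentations.IsNonarchimedeanLocalField
open Literature.NumberTheory.NumberFields
open Literature.AnabelianGeometry.AbsoluteAnabelian
open Literature.AnabelianGeometry.AbsoluteAnabelian.Prop121vii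

variable {K : Type} [Field K] [NumberField K] {n : ℕ} [NeZero n]
  (L : IntermediateField K (AlgebraicClosure K)) [FiniteDimensional K L] [IsAbelianGalois K L]
  [NumberField L]


/-! ### §2. The identity at every finite place, for every `b ∈ Kˣ` -/

section Main

/-- **Serre, *Corps locaux* XIV §1 Prop. 3 — `(χ, b)_v = χ(s_b)` — for the restriction `χ = ψ ∘ res_v`
of a global cyclic character, at EVERY finite place `v` and for EVERY `b ∈ Kˣ`**: the local invariant
`inv_v (loc_v (κₙ(b) ∪ ψ))` (THE residue map of `K_v`) equals `-ψ(res_v w)` for any `w ∈ W_{K_v}` with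
`Art_v w = b` — that is, `ψ̄(ψ_{L|K}⟨b⟩_v)` for the local Artin symbol
(`artinIdeleMap_localUnits_canonicalArtin_eq_inv`; Deligne's normalisation of `Art_v`).  No hypothesis
on `b`, on the ramification of `ψ` at `v`, or on the real places of `K`: the side conditions of
`…_of_forall_ne` are removed by weak approximation (both sides are additive in `b` and vanish on the open
subgroup of local norms from `K_vL` that are `n`-th powers in `K_v`).
[cite: SerreLocalFields1979, XIV §1 Prop. 3] [cite: CasselsFrohlichANT1967, Ch. VII §11] -/
theorem localInvariantMap_localization_cupProduct_δ₀_eq_neg_apply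
    (ψ : CyclicCharacter (absoluteGaloisGroup K) n) (hker : ψ.ker = galFixing K L) (b : Kˣ)
    (v : HeightOneSpectrum (𝓞 K)) (w : WeilGroup (v.adicCompletion K))
    (hw : canonicalArtin (v.adicCompletion K) w = globalToLocalUnits v b) :
    haveI : CompactSpace (absoluteGaloisGroup K) := absoluteGaloisGroup_compactSpace K
    localInvariantMap K n v (galoisCohomology.localization (mu K n) (Sum.inr v) 2
        (((mu K n).tateDualPairing n).cupProduct
          ((isSES_kummer K n (NeZero.pos n)).δ₀ (baseUnitsInvariant K (b : K) b.ne_zero))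
          (oneCocycleClass _ (scalarCocycle ψ)))) =
      -ψ (absGaloisRestrict K (v.adicCompletion K) (WeilGroup.toAbsGalois (v.adicCompletion K) w)) := by
  classical
  haveI : CompactSpace (absoluteGaloisGroup K) := absoluteGaloisGroup_compactSpace K
  -- `n = 1`: nothing to prove
  rcases Nat.lt_or_ge 1 n with hn1 | hn1
  swap
  · have hn : n = 1 := le_antisymm hn1 (NeZero.pos n)
    subst hn
    exact Subsingleton.elim _ _
  set F := v.adicCompletion K with hF
  haveI : CharZero F := charZero_adicCompletion v
  have ha := isLocalArtinMap_canonicalArtin_holds F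
  set hR := artinReciprocity_character_holds
  set A := artinIdeleMap L hR with hA
  obtain ⟨ψbar, hψbar_apply⟩ := exists_character_absRestrictNormalHom_eq L ψ hker
  -- the two sides as functions of `b ∈ Kˣ`
  set g := oneCocycleClass ((mu K n).tateDual n).toTopRep (scalarCocycle ψ) with hg
  set I : Kˣ → ZMod n := fun b' => localInvariantMap K n v (galoisCohomology.localization (mu K n) (Sum.inr v) 2
    (((mu K n).tateDualPairing n).cupProduct
      ((isSES_kummer K n (NeZero.pos n)).δ₀ (baseUnitsInvariant K (b' : K) b'.ne_zero)) g)) with hI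
  set R : Fˣ →* Multiplicative (ZMod n) := ψbar.comp (A.comp (localUnits v)) with hRdef
  have hRapply : ∀ x : Fˣ, R x = ψbar (A (localUnits v x)) := fun x => rfl
  -- `R (Art_v w') = -ψ(res w')`
  have hR_art : ∀ w' : WeilGroup F, Multiplicative.toAdd (R (canonicalArtin F w')) =
      -ψ (absGaloisRestrict K F (WeilGroup.toAbsGalois F w')) := fun w' => by
    rw [hRapply, hA, artinIdeleMap_localUnits_canonicalArtin_eq_inv L w', map_inv, hψbar_apply, toAdd_inv,
      toAdd_ofAdd]
  -- additivity of `I`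
  have hImul : ∀ b₁ b₂ : Kˣ, I (b₁ * b₂) = I b₁ + I b₂ := by
    intro b₁ b₂
    have hbase : baseUnitsInvariant K ((b₁ * b₂ : Kˣ) : K) (b₁ * b₂).ne_zero =
        baseUnitsInvariant K (b₁ : K) b₁.ne_zero + baseUnitsInvariant K (b₂ : K) b₂.ne_zero :=
      baseUnitsInvariant_mul K (b₁ : K) (b₂ : K) b₁.ne_zero b₂.ne_zero
    simp only [hI]
    rw [hbase, map_add, map_add, LinearMap.add_apply]
    erw [map_add, map_add]
  -- the local norm group `N_v` and `R` kills it
  set Nv : Subgroup Fˣ := (Units.map (Algebra.norm F : (IntermediateField.adjoin F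
      (Set.range ((absClosureEmbedding K F).comp L.val))) →* F)).range with hNv
  have hR_norm : ∀ x ∈ Nv, R x = 1 := fun x hx => by
    rw [hRapply, (artinIdeleMap_localUnits_eq_one_iff_mem_range_norm L x).mpr hx, map_one]
  -- `I` kills the local `n`-th powers
  have hI_pow : ∀ u : Kˣ, (∃ t : F, algebraMap K F (u : K) = t ^ n) → I u = 0 := by
    rintro u ⟨t, ht⟩
    simp only [hI]
    rw [localization_cupProduct_δ₀_eq_zero_of_eq_pow v (u : K) u.ne_zero ht, map_zero]
  -- a norm modulus `S₀`: `ψ` is unramified off `S₀`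
  obtain ⟨S₀, hS₀⟩ := exists_map_unitIdelesOutside_le K (normClassGroup K L) (isOpen_normClassGroup' L)
  -- §1 for the `b₁` satisfying the side conditions
  have hside : ∀ b₁ : Kˣ,
      (∀ (w' : InfinitePlace K) (hw' : w'.IsReal),
        0 < InfinitePlace.Completion.extensionEmbeddingOfIsReal hw' (algebraMap K w'.Completion (b₁ : K))) →
      (∀ v' ∈ S₀, v' ≠ v → ∃ t : v'.adicCompletion K, algebraMap K (v'.adicCompletion K) (b₁ : K) = t ^ n) →
      I b₁ = Multiplicative.toAdd (R (globalToLocalUnits v b₁)) := by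
    intro b₁ hpos₁ hpow₁
    obtain ⟨w₁, hw₁⟩ := ha.isOpenQuotientMap_artin.surjective (globalToLocalUnits v b₁)
    have h := localInvariantMap_localization_cupProduct_δ₀_eq_neg_apply_of_forall_ne L ψ hker b₁ v hpos₁
      (fun v' hv' hramv' => ?_) w₁ hw₁
    · simp only [hI]
      rw [h, ← hR_art w₁, hw₁]
    · by_cases hv'S₀ : v' ∈ S₀
      · obtain ⟨t, ht⟩ := hpow₁ v' hv'S₀ hv'
        exact localization_cupProduct_δ₀_eq_zero_of_eq_pow v' (b₁ : K) b₁.ne_zero ht _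
      · exfalso
        obtain ⟨σ, hσ, hne⟩ := hramv'
        exact hne (apply_absGaloisRestrict_eq_zero_of_mem_absInertia_of_not_mem L ψ hker hS₀ hv'S₀ σ hσ)
  -- the open subgroup `U = N_v ∩ (K_vˣ)^n`
  set U : Subgroup Fˣ := Nv ⊓ (powMonoidHom n : Fˣ →* Fˣ).range with hU
  have hUopen : IsOpen (U : Set Fˣ) := by
    haveI : Nv.FiniteIndex := ⟨index_range_norm_ne_zero L⟩
    have h1 : IsOpen (Nv : Set Fˣ) := Subgroup.isOpen_of_finiteIndex_units_localField (K := F) Nv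
    have h2 : IsOpen (((powMonoidHom n : Fˣ →* Fˣ).range : Subgroup Fˣ) : Set Fˣ) :=
      isOpen_range_powMonoidHom_units F (Nat.cast_ne_zero.mpr (NeZero.ne n))
    exact h1.inter h2
  -- `Units.val : K_v'ˣ → K_v'` is an open embedding (any finite place `v'`)
  have hvalopen : ∀ v' : HeightOneSpectrum (𝓞 K),
      IsOpenMap (Units.val : (v'.adicCompletion K)ˣ → v'.adicCompletion K) := by
    intro v'
    have hrange : Set.range (Units.val : (v'.adicCompletion K)ˣ → v'.adicCompletion K) = {0}ᶜ := by
      ext x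
      simp only [Set.mem_range, Set.mem_compl_iff, Set.mem_singleton_iff]
      exact ⟨fun ⟨u, hu⟩ => hu ▸ u.ne_zero, fun hx => ⟨Units.mk0 x hx, rfl⟩⟩
    exact (⟨Units.isEmbedding_val₀, by rw [hrange]; exact isOpen_compl_singleton⟩ :
      Topology.IsOpenEmbedding (Units.val : (v'.adicCompletion K)ˣ → v'.adicCompletion K)).isOpenMap
  -- weak approximation at `S = {v} ∪ S₀` and the real places
  set S : Finset (HeightOneSpectrum (𝓞 K)) := insert v S₀ with hS
  have hvS : v ∈ S := Finset.mem_insert_self v S₀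
  -- the target cosets: `b · U` at `v`, the `n`-th powers intersected with local norms elsewhere
  set Ugen : ∀ v' : HeightOneSpectrum (𝓞 K), Subgroup (v'.adicCompletion K)ˣ := fun v' =>
    (Units.map (Algebra.norm (v'.adicCompletion K) : (IntermediateField.adjoin (v'.adicCompletion K)
      (Set.range ((absClosureEmbedding K (v'.adicCompletion K)).comp L.val))) →* v'.adicCompletion K)).range ⊓
      (powMonoidHom n : (v'.adicCompletion K)ˣ →* (v'.adicCompletion K)ˣ).range with hUgen
  have hUgen_open : ∀ v' : HeightOneSpectrum (𝓞 K), IsOpen (Ugen v' : Set (v'.adicCompletion K)ˣ) := by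
    intro v'
    haveI : CharZero (v'.adicCompletion K) := charZero_adicCompletion v'
    haveI : (Units.map (Algebra.norm (v'.adicCompletion K) : (IntermediateField.adjoin (v'.adicCompletion K)
      (Set.range ((absClosureEmbedding K (v'.adicCompletion K)).comp L.val))) →* v'.adicCompletion K)).range.FiniteIndex :=
      ⟨index_range_norm_ne_zero L⟩
    exact (Subgroup.isOpen_of_finiteIndex_units_localField (K := v'.adicCompletion K) _).inter
      (isOpen_range_powMonoidHom_units (v'.adicCompletion K) (Nat.cast_ne_zero.mpr (NeZero.ne n)))
  set z : ∀ v' : HeightOneSpectrum (𝓞 K), (v'.adicCompletion K)ˣ := fun v' =>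
    if v' = v then globalToLocalUnits v' b else 1 with hz
  set C : ∀ v' : HeightOneSpectrum (𝓞 K), Set (v'.adicCompletion K)ˣ := fun v' =>
    (fun x => (z v')⁻¹ * x) ⁻¹' (Ugen v' : Set (v'.adicCompletion K)ˣ) with hCdef
  have hCopen : ∀ v', IsOpen (C v') := fun v' => (hUgen_open v').preimage (continuous_const_mul _)
  set O : Set ((∀ v' : S, v'.1.adicCompletion K) × InfiniteAdeleRing K) :=
    {p | (∀ v' : S, p.1 v' ∈ Units.val '' C v'.1) ∧
      ∀ (w' : InfinitePlace K) (hw' : w'.IsReal),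
        0 < InfinitePlace.Completion.extensionEmbeddingOfIsReal hw' (p.2 w')} with hOdef
  have hOopen : IsOpen O := by
    have h1 : IsOpen {p : (∀ v' : S, v'.1.adicCompletion K) × InfiniteAdeleRing K |
        ∀ v' : S, p.1 v' ∈ Units.val '' C v'.1} := by
      rw [Set.setOf_forall]
      exact isOpen_iInter_of_finite fun v' =>
        ((hvalopen v'.1) _ (hCopen v'.1)).preimage ((continuous_apply v').comp continuous_fst)
    have h2 : IsOpen {p : (∀ v' : S, v'.1.adicCompletion K) × InfiniteAdeleRing K |
        ∀ (w' : InfinitePlace K) (hw' : w'.IsReal),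
          0 < InfinitePlace.Completion.extensionEmbeddingOfIsReal hw' (p.2 w')} := by
      rw [Set.setOf_forall]
      refine isOpen_iInter_of_finite fun w' => ?_
      by_cases hw' : w'.IsReal
      · have hc : Continuous fun p : (∀ v' : S, v'.1.adicCompletion K) × InfiniteAdeleRing K =>
            InfinitePlace.Completion.extensionEmbeddingOfIsReal hw' (p.2 w') :=
          (InfinitePlace.Completion.isometry_extensionEmbeddingOfIsReal hw').continuous.comp
            ((continuous_apply w').comp continuous_snd)
        have : {p : (∀ v' : S, v'.1.adicCompletion K) × InfiniteAdeleRing K |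
            ∀ hw'' : w'.IsReal, 0 < InfinitePlace.Completion.extensionEmbeddingOfIsReal hw'' (p.2 w')} =
            (fun p => InfinitePlace.Completion.extensionEmbeddingOfIsReal hw' (p.2 w')) ⁻¹' Set.Ioi 0 := by
          ext p
          simp only [Set.mem_setOf_eq, Set.mem_preimage, Set.mem_Ioi]
          exact ⟨fun h => h hw', fun h _ => h⟩
        rw [this]
        exact isOpen_Ioi.preimage hc
      · have : {p : (∀ v' : S, v'.1.adicCompletion K) × InfiniteAdeleRing K |
            ∀ hw'' : w'.IsReal, 0 < InfinitePlace.Completion.extensionEmbeddingOfIsReal hw'' (p.2 w')} = Set.univ :=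
          Set.eq_univ_of_forall fun p hw'' => absurd hw'' hw'
        rw [this]
        exact isOpen_univ
    exact h1.inter h2
  have hOne : O.Nonempty := by
    refine ⟨(fun v' => ((z v'.1 : (v'.1.adicCompletion K)ˣ) : v'.1.adicCompletion K), fun _ => 1), fun v' => ?_,
      fun w' hw' => ?_⟩
    · refine ⟨z v'.1, ?_, rfl⟩
      change (z v'.1)⁻¹ * z v'.1 ∈ (Ugen v'.1 : Set (v'.1.adicCompletion K)ˣ)
      rw [inv_mul_cancel]
      exact (Ugen v'.1).one_mem
    · change 0 < InfinitePlace.Completion.extensionEmbeddingOfIsReal hw' 1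
      rw [map_one]; exact one_pos
  obtain ⟨k, hk⟩ := (denseRange_algebraMap_pi_prod (K := K) S).exists_mem_open hOopen hOne
  obtain ⟨hkfin, hkinf⟩ := hk
  -- `k ≠ 0` and the unit `b₁`
  obtain ⟨xv, hxvC, hxv⟩ := hkfin ⟨v, hvS⟩
  have hk0 : k ≠ 0 := by
    intro h
    apply xv.ne_zero
    rw [hxv]
    change algebraMap K F k = 0
    rw [h, map_zero]
  set b₁ : Kˣ := Units.mk0 k hk0 with hb₁
  have hb₁v : globalToLocalUnits v b₁ = xv := Units.ext (by rw [val_globalToLocalUnits, hxv]; rfl)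
  -- `b₁` satisfies the side conditions
  have hpos₁ : ∀ (w' : InfinitePlace K) (hw' : w'.IsReal),
      0 < InfinitePlace.Completion.extensionEmbeddingOfIsReal hw' (algebraMap K w'.Completion (b₁ : K)) :=
    fun w' hw' => hkinf w' hw'
  have hpow₁ : ∀ v' ∈ S₀, v' ≠ v →
      ∃ t : v'.adicCompletion K, algebraMap K (v'.adicCompletion K) (b₁ : K) = t ^ n := by
    intro v' hv' hne
    obtain ⟨x, hxC, hx⟩ := hkfin ⟨v', Finset.mem_insert_of_mem hv'⟩
    have hxU : x ∈ Ugen v' := by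
      have h := hxC
      change (z v')⁻¹ * x ∈ (Ugen v' : Set (v'.adicCompletion K)ˣ) at h
      simp only [hz, if_neg hne, inv_one, one_mul] at h
      exact h
    obtain ⟨y, hy⟩ := (Subgroup.mem_inf.mp hxU).2
    have hx' : (x : v'.adicCompletion K) = algebraMap K (v'.adicCompletion K) k := hx
    refine ⟨(y : v'.adicCompletion K), ?_⟩
    change algebraMap K (v'.adicCompletion K) k = _
    rw [← hx', ← hy, powMonoidHom_apply, Units.val_pow_eq_pow_val]
  have hIb₁ := hside b₁ hpos₁ hpow₁
  -- `u = b⁻¹ b₁` lies in `U` at `v`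
  set u : Kˣ := b⁻¹ * b₁ with hu
  have huU : globalToLocalUnits v u ∈ U := by
    have h := hxvC
    change (z v)⁻¹ * xv ∈ (Ugen v : Set Fˣ) at h
    simp only [hz, if_pos rfl] at h
    rw [hu, map_mul, map_inv, hb₁v]
    exact h
  have hRu : R (globalToLocalUnits v u) = 1 := hR_norm _ (Subgroup.mem_inf.mp huU).1
  have hIu : I u = 0 := by
    obtain ⟨y, hy⟩ := (Subgroup.mem_inf.mp huU).2
    refine hI_pow u ⟨(y : F), ?_⟩
    rw [← val_globalToLocalUnits, ← hy, powMonoidHom_apply, Units.val_pow_eq_pow_val]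
  -- conclude
  have hb₁eq : b₁ = b * u := by rw [hu, mul_inv_cancel_left]
  have hI_b : I b = Multiplicative.toAdd (R (globalToLocalUnits v b)) := by
    have h := hIb₁
    rw [hb₁eq, hImul, hIu, add_zero, map_mul, map_mul, hRu, mul_one] at h
    exact h
  have hgoal := hI_b
  simp only [hI] at hgoal
  rw [hgoal, ← hw, hR_art]

/-- **Serre, *Corps locaux* XIV §1 Prop. 2 Cor. 1, at a completion: `loc_v (κₙ(b) ∪ ψ) = 0 ↔ b ∈ N_{K_vL/K_v}((K_vL)ˣ)`**
(the cyclic class vanishes at `v` iff `b` is a norm from the compositum `K_vL`).  `⇒` is the tree's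
`mem_range_norm_compositum_of_resMu_cupProduct_δ₀_eq_zero`; `⇐` (new) follows from
`localInvariantMap_localization_cupProduct_δ₀_eq_neg_apply`: the invariant is `ψ̄(ψ_{L|K}⟨b⟩_v)`, the Artin
symbol of a local norm is trivial (`artinIdeleMap_localUnits_eq_one_iff_mem_range_norm`), and `inv_v` is
injective (`localInvariantMap_bijective`). [cite: SerreLocalFields1979, XIV §1 Prop. 2 Cor. 1]
[cite: NeukirchANT1999, Ch. VI §5 Cor. (5.8)] -/
theorem localization_cupProduct_δ₀_eq_zero_iff_mem_range_norm
    (ψ : CyclicCharacter (absoluteGaloisGroup K) n) (hker : ψ.ker = galFixing K L) (b : Kˣ)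
    (v : HeightOneSpectrum (𝓞 K)) :
    haveI : CompactSpace (absoluteGaloisGroup K) := absoluteGaloisGroup_compactSpace K
    galoisCohomology.localization (mu K n) (Sum.inr v) 2
        (((mu K n).tateDualPairing n).cupProduct
          ((isSES_kummer K n (NeZero.pos n)).δ₀ (baseUnitsInvariant K (b : K) b.ne_zero))
          (oneCocycleClass _ (scalarCocycle ψ))) = 0 ↔
      globalToLocalUnits v b ∈ (Units.map (Algebra.norm (v.adicCompletion K) :
        (IntermediateField.adjoin (v.adicCompletion K)
          (Set.range ((absClosureEmbedding K (v.adicCompletion K)).comp L.val))) →* v.adicCompletion K)).range := by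
  haveI : CompactSpace (absoluteGaloisGroup K) := absoluteGaloisGroup_compactSpace K
  constructor
  · intro h0
    have hres : resMu K (v.adicCompletion K) n 2 (((mu K n).tateDualPairing n).cupProduct
        ((isSES_kummer K n (NeZero.pos n)).δ₀ (baseUnitsInvariant K (b : K) b.ne_zero))
        (oneCocycleClass _ (scalarCocycle ψ))) = 0 := by
      rw [← cohomologyMap_muLocalIso_localization, h0]; exact map_zero _
    exact mem_range_norm_compositum_of_resMu_cupProduct_δ₀_eq_zero v L ψ hker b hres
  · intro hnorm
    obtain ⟨w, hw⟩ := (isLocalArtinMap_canonicalArtin_holds (v.adicCompletion K)).isOpenQuotientMap_artin.surjective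
      (globalToLocalUnits v b)
    have h := localInvariantMap_localization_cupProduct_δ₀_eq_neg_apply L ψ hker b v w hw
    -- the Artin symbol of the local norm `b = Art_v w` is trivial, so `(res w)|_L = 1` and `ψ(res w) = 0`
    have h1 : artinIdeleMap L artinReciprocity_character_holds (localUnits v (globalToLocalUnits v b)) = 1 :=
      (artinIdeleMap_localUnits_eq_one_iff_mem_range_norm L _).mpr hnorm
    rw [← hw, artinIdeleMap_localUnits_canonicalArtin_eq_inv L w, inv_eq_one, absRestrictNormalHom_eq_one_iff] at h1
    have h2 : absGaloisRestrict K (v.adicCompletion K) (WeilGroup.toAbsGalois (v.adicCompletion K) w) ∈ ψ.ker := by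
      rw [hker]; exact h1
    rw [(CyclicCharacter.mem_ker _).mp h2, neg_zero] at h
    exact (localInvariantMap_bijective (K := K) (n := n) v).1 (h.trans (map_zero _).symm)

end Main


end Literature.NumberTheory.GaloisCohomology

end
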